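import Mathlib

/-!
# STUB-IDEAS k2 (gen 29) — R188 «THE PERIOD DIGIT IS A RATIO OF PERIOD PAIRS»

Stub of record: `stub_heegnerIndexLowerAtTwo` (crux `PrintCf2.SplitBadTwoLowerHalfOfFacts`,
stmt-BirchSwinnertonDyer-27851, skeleton sha16 `f2bd84c029a8a938`).  Node attacked: STUB-PLAN v5.3
**R188** (the value-grade digit left by k2-g28's `klf_scaled_of_tables`: `Col(u_W) = π_W • 𝓛_W`,
is `v₂(π_W)` constant on each dyadic key?).

TYPED DICTIONARY (object ↦ object), all objects of road RT⁺ / k3-g26's cut `(3)₂`: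
* `PeriodPair.cx` ↦ a complex period `∫_γ ω` (Kato Thm 16.2: `per(ω) = Ω₊γ⁺ + Ω₋γ⁻`; de Shalit II.4.4:
  `L = Ω𝔣` the period lattice of the good model);
* `PeriodPair.pd` ↦ the 2-adic period of THE SAME differential: Kato `⟨ω, η_int⟩` for the integral
  unit-root generator `η_int` of Prop 17.11 / 17.5 (so that `Col₀ := 𝓛_{η_int}` and
  `𝓛_{η_int}(z_γ) = ⟨ω, η_int⟩ · L_{p,α,ω,γ}` by Thm 16.6 and the `F_λ`-linearity of `η ↦ 𝓛_η`);
  de Shalit `Ω_p = θ′(0)` (II.4.4 (11), II.4.13), Rubin (Cetraro 1999) Thm 12.10 `Ω_p ∈ 𝒟^×`;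
* `PeriodPair.rescale l` ↦ `ω ↦ l·ω` (Kato Rem 16.3 (2): `L_{p,α,aω,bγ} = a⁻¹ b L_{p,α,ω,γ}`);
* `transport P₀ l a u` ↦ «same motive»: every member `W`, its good partner `A′ = W^{(e)}` and de
  Shalit's ray-class model are `ℚ̄`-isomorphic CM curves, so each side's pair is the reference pair
  `P₀ = (∫_{γ₀} ω₀, ⟨ω₀, η₀⟩)` of ONE good model moved by a differential scalar `l ∈ ℚ̄ˣ`, a Betti
  scalar `a ∈ K₀ˣ` (`γ = a·γ₀` in the `K₀`-line `H₁ ⊗ ℚ`) and a crystalline scalar `u` (a unit: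
  two integral generators of one `ℤ₂^{ur}`-line);
* `katoConst` / `katzConst` ↦ the normalisation columns `c_K(χ)`, `c_Z(χ)` of k2-g28's two
  `ValueTable`s; `A`, `B` ↦ their algebraic columns (Gauss sums, `2ⁿα⁻ⁿ`, Euler factors, the
  `χ_e`-twist column) — R189's business, entering here only through `ord v (A / B)`;
* `periodDigit` ↦ `π_W = c_K / c_Z`;
* `nm`, `cj` ↦ `O_{K₀} = ℤ[ω]`, `ω = (1+√−7)/2`, and complex conjugation on the period lattice
  `Λ_W = Ω₊(W)·𝔏` of a member (`𝔏 ⊇ O`, `𝔏̄ = 𝔏`, `𝔏 ∩ ℚ = ℤ`);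
* `ord v` ↦ the valuation of `ℚ̄ ⊂ ℂ₂` (inducing de Shalit's `𝔭` on `K₀`).

WHAT IS PROVED HERE (kernel, 0 sorry): (i) the reference pair AND both differential scalars CANCEL
in `π_W` (`periodDigit_transport`) — so the Manin constant, the `c₄/c₆`-rescaling of the twisted
minimal model and `√d`, `√e` never enter; (ii) the exact digit formula `ord π_W = (κuK − κaK) − (κuZ − κaZ) + ord(A/B)`
(`ord_periodDigit_transport_eq`, `R188_cellUniform`) and its unit case (`ord_periodDigit_transport`); (iii) the Betti digits vanish for `K₀ = ℚ(√−7)`: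
a primitive conjugation-eigenvector of `O_{K₀}` (resp. `ℤ[√−7]`) has norm `1` (real line) or `7`
(imaginary line, spanned by `√−7`) — ODD, hence a unit at both primes above `2`
(`nm_eq_one_of_real_primitive`, `nm_eq_seven_of_imag_primitive`, `isUnit_padicInt_two_of_odd`,
`isUnit_of_mul_conj`), so `Ω₋/Ω₊ = √−7` carries no dyadic digit and the sign of `d` (not a key
invariant: `same_key_opposite_signs`) is harmless; (iii′) in Kato's cohomological normalisation the
ONLY Betti digit is the index `[H¹ : H¹⁺ ⊕ H¹⁻] ∈ {2, 1}`, i.e. `κaK = −1` on maximal-type members,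
`0` on order-`2`-type members (§5b, `primitive_fixed_dualRow`, `primitive_fixed_dualRow'`);
(iv) key tables (`partner_good`, `unitRootClass_table`) and the decidable core of the isogeny digit for
order-`2`-type members (§7b: `cm7_rational_two_torsion`, `cm7_mod_two_points` — the kernel of
`49a1 → 49a2` is étale at `2`, so the up-isogeny is `[2]·unit` on formal groups: `κuZ = −1` there,
replacing the index digit; net digit `1` for every member); (v) the k3-g26-shaped corollaries
`R188_cellUniform`, `R188_keyUniform`.
WHAT IS CITED, NOT PROVED: Kato Ast. 295 Rem 16.3 (2), Thm 16.6, 17.5 («good ω ⟺ Néron» for the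
good ordinary partner, any `p`), Prop 17.11, 14.18; de Shalit 1987 II.4.4, II.4.13 (`Ω′_p, Ω″_p`
units), II.4.14 (36) (homogeneous in `⟨Ω, Ω_p⟩`); Rubin 1999 Thm 12.10.  BSD is NOT proved by any
of this; nothing here closes the stub, the crux, `(3)₂` or R189/R190.
-/

set_option linter.dupNamespace false

namespace Summit.BirchSwinnertonDyer.BirchSwinnertonDyer.Cruxes.SplitBadTwoLowerHalfOfFacts.PeriodPairK2G29

/-! ## §1  Additive reading of a multiplicative valuation on the group of period symbols -/

section OrdBook

variable {Γ : Type*} [CommGroup Γ] (v : Γ →* Multiplicative ℤ)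

/-- `ord v x` = the valuation of `x`, read additively. -/
def ord (x : Γ) : ℤ := Multiplicative.toAdd (v x)

@[simp] theorem ord_mul (x y : Γ) : ord v (x * y) = ord v x + ord v y := by
  simp [ord, map_mul]

@[simp] theorem ord_one : ord v 1 = 0 := by simp [ord]

@[simp] theorem ord_inv (x : Γ) : ord v x⁻¹ = -ord v x := by simp [ord, map_inv]

@[simp] theorem ord_div (x y : Γ) : ord v (x / y) = ord v x - ord v y := by
  simp [div_eq_mul_inv, sub_eq_add_neg]

theorem ord_pow (x : Γ) (n : ℕ) : ord v (x ^ n) = n * ord v x := by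
  induction n with
  | zero => simp
  | succ n ih => simp [pow_succ, ih]; ring

/-- Square roots of valuation-zero elements have valuation zero (the `√−7`, `1/√−7` digits). -/
theorem ord_eq_zero_of_sq_eq {r s : Γ} (h : r ^ 2 = s) (hs : ord v s = 0) : ord v r = 0 := by
  have h2 : ord v (r ^ 2) = 2 * ord v r := by simpa using ord_pow v r 2
  rw [h, hs] at h2
  omega

end OrdBook

/-! ## §2  Period pairs and the ω-free ratio (Kato Rem 16.3 (2)) -/

/-- A period PAIR of ONE differential: complex entry `cx = ∫_γ ω`, 2-adic entry `pd = ⟨ω, η⟩`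
(Kato 17.5 / 17.11) resp. `θ′(0)` (de Shalit II.4.4 (11)).  Abstract symbols in a comm group. -/
structure PeriodPair (Γ : Type*) [CommGroup Γ] where
  /-- complex period of `ω` against the Betti element -/
  cx : Γ
  /-- 2-adic period of the same `ω` against the unit-root crystalline generator -/
  pd : Γ

namespace PeriodPair

variable {Γ : Type*} [CommGroup Γ]

/-- `ω ↦ l • ω` rescales BOTH entries (Kato Rem 16.3 (2); de Shalit (34)/(36) homogeneity). -/
def rescale (l : Γ) (P : PeriodPair Γ) : PeriodPair Γ := ⟨l * P.cx, l * P.pd⟩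

/-- The ω-free invariant `pd / cx`. -/
def ratio (P : PeriodPair Γ) : Γ := P.pd / P.cx

@[simp] theorem ratio_rescale (l : Γ) (P : PeriodPair Γ) : (P.rescale l).ratio = P.ratio := by
  simp [rescale, ratio, mul_div_mul_left_eq_div]

/-- «Same motive»: a pair obtained from the reference pair `P₀` of ONE good CM model by a
differential scalar `l`, a Betti scalar `a` (`γ = a • γ₀` in the `K₀`-line) and a crystalline
scalar `u` (`η = u • η₀`). -/
def transport (P₀ : PeriodPair Γ) (l a u : Γ) : PeriodPair Γ := ⟨l * a * P₀.cx, l * u * P₀.pd⟩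

theorem ratio_transport (P₀ : PeriodPair Γ) (l a u : Γ) :
    (P₀.transport l a u).ratio = u / a * P₀.ratio := by
  simp only [transport, ratio, div_mul_div_comm, mul_assoc]
  exact mul_div_mul_left_eq_div _ _ _

end PeriodPair

/-! ## §3  The two normalisation columns and the period digit `π_W` -/

section Digit

variable {Γ : Type*} [CommGroup Γ]

/-- Kato-side column constant at one character: `c_K = (⟨ω,η_int⟩ / ∫_γ ω) · A`
(Thm 16.2 (i) ∘ Thm 16.6 with `η_int` of Prop 17.11; `A` = Gauss sum · `2ⁿα⁻ⁿ` · Euler · twist). -/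
def katoConst (P : PeriodPair Γ) (A : Γ) : Γ := P.ratio * A

/-- Katz / de Shalit-side column constant: `c_Z = (Ω_p / Ω) · B` (II.4.14 (36) at type `(1,0)`). -/
def katzConst (Q : PeriodPair Γ) (B : Γ) : Γ := Q.ratio * B

/-- R188's period digit `π_W = c_K / c_Z` (k2-g28 `klf_scaled_of_tables`: `Col (u i) = π i • 𝓛 i`). -/
def periodDigit (P Q : PeriodPair Γ) (A B : Γ) : Γ := katoConst P A / katzConst Q B

/-- Rescaling EITHER differential leaves `π_W` unchanged: the Manin constant, the minimal-model
rescaling `u_d`, `1/√d` and `1/√e` are invisible in `π_W`. -/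
@[simp] theorem periodDigit_rescale (P Q : PeriodPair Γ) (A B lK lZ : Γ) :
    periodDigit (P.rescale lK) (Q.rescale lZ) A B = periodDigit P Q A B := by
  simp [periodDigit, katoConst, katzConst]

/-- **The reference pair cancels.**  If both sides are transports of the reference pair `P₀` of one
good CM model, then `π_W = (u_K · a_Z)/(u_Z · a_K) · (A/B)` — no period of any kind survives, only
the Betti scalars, the crystalline scalars and the algebraic columns. -/
theorem periodDigit_transport (P₀ : PeriodPair Γ) (lK aK uK lZ aZ uZ A B : Γ) :
    periodDigit (P₀.transport lK aK uK) (P₀.transport lZ aZ uZ) A B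
      = (uK / aK) / (uZ / aZ) * (A / B) := by
  simp only [periodDigit, katoConst, katzConst, PeriodPair.ratio_transport]
  rw [mul_div_mul_comm, mul_div_mul_right_eq_div]

variable (v : Γ →* Multiplicative ℤ)

/-- **R188 DIGIT FORMULA (no hypotheses).**  `ord π_W = (ord u_K − ord a_K) − (ord u_Z − ord a_Z)
+ (ord A − ord B)`: the period digit is the signed sum of two crystalline digits, two Betti digits
and the column digit — nothing else. -/
theorem ord_periodDigit_transport_eq (P₀ : PeriodPair Γ) (lK aK uK lZ aZ uZ A B : Γ) :
    ord v (periodDigit (P₀.transport lK aK uK) (P₀.transport lZ aZ uZ) A B)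
      = (ord v uK - ord v aK) - (ord v uZ - ord v aZ) + (ord v A - ord v B) := by
  rw [periodDigit_transport]
  simp only [ord_mul, ord_div]

/-- **R188 DIGIT LAW, unit case.**  Four vanishing digits ⟹ `ord π_W = ord (A/B)`:
`ord u_K = 0` (Kato 17.5: the Néron differential of the good ordinary partner `A′` is «good», i.e.
pairs to a unit with the integral unit-root generator; two integral generators differ by a unit),
`ord u_Z = 0` (de Shalit II.4.13 / Rubin Thm 12.10: `Ω_p ∈ 𝒟^×`),
`ord a_Z = 0` (Rubin §7.4/p. 248: `L = Ω O` for the model minimal at `𝔭`; de Shalit `L = Ω𝔣`,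
`(𝔣, 𝔭) = 1`), and `ord a_K = 0` WHEN the Betti element is normalised in HOMOLOGY (§5).  With
Kato's COHOMOLOGICAL normalisation (14.18: `γ^±` bases of `T^± ⊂ H¹`) the Betti digit of a
maximal-order member is `−1` instead (§5b) — use `ord_periodDigit_transport_eq` /
`R188_cellUniform` with that constant. -/
theorem ord_periodDigit_transport (P₀ : PeriodPair Γ) (lK aK uK lZ aZ uZ A B : Γ)
    (huK : ord v uK = 0) (huZ : ord v uZ = 0) (haK : ord v aK = 0) (haZ : ord v aZ = 0) :
    ord v (periodDigit (P₀.transport lK aK uK) (P₀.transport lZ aZ uZ) A B) = ord v A - ord v B := by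
  rw [ord_periodDigit_transport_eq, huK, huZ, haK, haZ]
  ring

end Digit

/-! ## §4  The key-uniform corollary in k3-g26 / k2-g28 shape -/

section KeyUniform

variable {Γ : Type*} [CommGroup Γ] (v : Γ →* Multiplicative ℤ) {J : Type*}

/-- **R188, CELL-UNIFORM FORM.**  If on a cell of members (one dyadic key, one CM-order type) the
five digits are constants — crystalline `κuK`, `κuZ`, Betti `κaK`, `κaZ`, column `κA − κB` — then
`ord π` is the constant `(κuK − κaK) − (κuZ − κaZ) + (κA − κB)` on the cell.  This is the form the
sources give: `κuK = κuZ = κaZ = 0`, `κaK ∈ {−1, 0}` by CM-order type (§5b), `κA − κB` a function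
of `e(key)` (R189). -/
theorem R188_cellUniform (P₀ : PeriodPair Γ) (lK aK uK lZ aZ uZ A B : J → Γ)
    (κuK κuZ κaK κaZ κA κB : ℤ)
    (huK : ∀ i, ord v (uK i) = κuK) (huZ : ∀ i, ord v (uZ i) = κuZ)
    (haK : ∀ i, ord v (aK i) = κaK) (haZ : ∀ i, ord v (aZ i) = κaZ)
    (hA : ∀ i, ord v (A i) = κA) (hB : ∀ i, ord v (B i) = κB) :
    ∀ i, ord v (periodDigit (P₀.transport (lK i) (aK i) (uK i)) (P₀.transport (lZ i) (aZ i) (uZ i))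
        (A i) (B i)) = (κuK - κaK) - (κuZ - κaZ) + (κA - κB) := by
  intro i
  rw [ord_periodDigit_transport_eq, huK, huZ, haK, haZ, hA, hB]

/-- **R188, delivered (modulo R189's column match).**  For the members `i : J` of ONE dyadic key:
each side's period pair is a transport of the reference pair; the crystalline and Betti scalars
have valuation `0`; the algebraic columns differ by a ratio `t` depending on the key only (through
`e(key)`: the `χ_e`-twist / Gauss-sum column and the `Δ`-descent digit (12.1.2)).  Then `ord π_i`
is the constant `ord t` — the hypothesis k3-g26's `threeTwo_keyUniform_of_cut` needs after
k2-g28's `klf_scaled_of_tables`. -/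
theorem R188_keyUniform (P₀ : PeriodPair Γ) (lK aK uK lZ aZ uZ A B : J → Γ) (t : Γ)
    (huK : ∀ i, ord v (uK i) = 0) (huZ : ∀ i, ord v (uZ i) = 0)
    (haK : ∀ i, ord v (aK i) = 0) (haZ : ∀ i, ord v (aZ i) = 0)
    (hcol : ∀ i, A i = t * B i) :
    ∃ c : ℤ, ∀ i,
      ord v (periodDigit (P₀.transport (lK i) (aK i) (uK i)) (P₀.transport (lZ i) (aZ i) (uZ i))
        (A i) (B i)) = c := by
  refine ⟨ord v t, fun i => ?_⟩
  rw [ord_periodDigit_transport v P₀ _ _ _ _ _ _ _ _ (huK i) (huZ i) (haK i) (haZ i), hcol i]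
  simp

/-- Member-FREE form: any two members of the class (possibly in different keys) differ in `ord π`
exactly by the difference of their column digits. -/
theorem ord_periodDigit_sub (P₀ : PeriodPair Γ) (lK aK uK lZ aZ uZ A B : J → Γ)
    (huK : ∀ i, ord v (uK i) = 0) (huZ : ∀ i, ord v (uZ i) = 0)
    (haK : ∀ i, ord v (aK i) = 0) (haZ : ∀ i, ord v (aZ i) = 0) (i j : J) :
    ord v (periodDigit (P₀.transport (lK i) (aK i) (uK i)) (P₀.transport (lZ i) (aZ i) (uZ i))
        (A i) (B i))
      - ord v (periodDigit (P₀.transport (lK j) (aK j) (uK j)) (P₀.transport (lZ j) (aZ j) (uZ j))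
        (A j) (B j))
      = (ord v (A i) - ord v (B i)) - (ord v (A j) - ord v (B j)) := by
  rw [ord_periodDigit_transport v P₀ _ _ _ _ _ _ _ _ (huK i) (huZ i) (haK i) (haZ i),
    ord_periodDigit_transport v P₀ _ _ _ _ _ _ _ _ (huK j) (huZ j) (haK j) (haZ j)]

end KeyUniform

/-! ## §5  Betti rigidity for `K₀ = ℚ(√−7)`: conjugation-eigenvectors have ODD norm

`O_{K₀} = ℤ[ω]`, `ω = (1 + √−7)/2`, `ω̄ = 1 − ω`, `ω ω̄ = 2`.  The period lattice of a member with
CM by `O_{K₀}` is `Λ_W = Ω₊(W) · 𝔏` with `O ⊆ 𝔏 ⊂ K₀`, `𝔏̄ = 𝔏` (the curve is defined over `ℝ`) and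
`𝔏 ∩ ℚ = ℤ` (`Ω₊` is the primitive real period); `𝔏 = c⁻¹ O` with `c ∈ O` PRIMITIVE and
`c̄ = ± c`.  Below: such `c` has norm `1` or `7`.  Consequently `𝔏 ∈ {O, (√−7)⁻¹ O}`, Kato's good
`γ⁺ ↔ 1`, `γ⁻ ↔ √−7` (or `1/√−7`), all of norm position `1`, `7` or `1/7` — units at `𝔭` and `𝔭̄`. -/

section Lattice

/-- Norm form of `x + yω ∈ ℤ[ω]`, `ω = (1+√−7)/2`: `N(x + yω) = x² + xy + 2y²`. -/
def nm (x y : ℤ) : ℤ := x ^ 2 + x * y + 2 * y ^ 2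

/-- Complex conjugation in the coordinates `(x, y) ↦ x + yω`: `ω̄ = 1 − ω`. -/
def cj (p : ℤ × ℤ) : ℤ × ℤ := (p.1 + p.2, -p.2)

theorem cj_cj (p : ℤ × ℤ) : cj (cj p) = p := by
  obtain ⟨x, y⟩ := p
  simp [cj]

theorem nm_cj (x y : ℤ) : nm (x + y) (-y) = nm x y := by
  unfold nm; ring

/-- The conjugation-FIXED vectors are the real line `y = 0`. -/
theorem cj_eq_self_iff (x y : ℤ) : cj (x, y) = (x, y) ↔ y = 0 := by
  show (x + y, -y) = (x, y) ↔ y = 0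
  simp only [Prod.mk.injEq]
  omega

/-- The ANTI-fixed vectors are the line `y = −2x`, spanned by `1 − 2ω = −√−7`. -/
theorem cj_eq_neg_iff (x y : ℤ) : cj (x, y) = (-x, -y) ↔ y = -2 * x := by
  show (x + y, -y) = (-x, -y) ↔ y = -2 * x
  rw [Prod.mk.injEq]
  constructor
  · rintro ⟨h, -⟩
    omega
  · intro h
    constructor <;> omega

/-- A PRIMITIVE real vector of `O_{K₀}` has norm `1` (it is `±1`). -/
theorem nm_eq_one_of_real_primitive {x y : ℤ} (hy : y = 0) (hp : Int.gcd x y = 1) :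
    nm x y = 1 := by
  subst hy
  have hx : x.natAbs = (1 : ℤ).natAbs := by simpa [Int.gcd_zero_right] using hp
  rcases Int.natAbs_eq_natAbs_iff.mp hx with rfl | rfl <;> simp [nm]

/-- A PRIMITIVE imaginary vector of `O_{K₀}` has norm `7` (it is `±√−7`). -/
theorem nm_eq_seven_of_imag_primitive {x y : ℤ} (hy : y = -2 * x) (hp : Int.gcd x y = 1) :
    nm x y = 7 := by
  subst hy
  have hdvd : x ∣ (Int.gcd x (-2 * x) : ℤ) := Int.dvd_coe_gcd (dvd_refl x) ⟨-2, by ring⟩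
  rw [hp] at hdvd
  rcases Int.isUnit_iff.mp (isUnit_of_dvd_one (by exact_mod_cast hdvd)) with rfl | rfl <;>
    simp [nm]

/-- Hence every primitive conjugation-eigenvector of `O_{K₀}` has ODD norm. -/
theorem odd_nm_of_eigen_primitive {x y : ℤ} (h : cj (x, y) = (x, y) ∨ cj (x, y) = (-x, -y))
    (hp : Int.gcd x y = 1) : Odd (nm x y) := by
  rcases h with h | h
  · rw [nm_eq_one_of_real_primitive ((cj_eq_self_iff x y).mp h) hp]; exact odd_one
  · rw [nm_eq_seven_of_imag_primitive ((cj_eq_neg_iff x y).mp h) hp]; exact ⟨3, by norm_num⟩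

/-- The `ℤ[√−7]` variant (members with CM by the order of conductor `2`, the `49a2`-shape):
`N(x + y√−7) = x² + 7y²`, conjugation `(x, y) ↦ (x, −y)`. -/
def nm' (x y : ℤ) : ℤ := x ^ 2 + 7 * y ^ 2

theorem nm'_eq_one_of_real_primitive {x y : ℤ} (hy : y = 0) (hp : Int.gcd x y = 1) :
    nm' x y = 1 := by
  subst hy
  have hx : x.natAbs = (1 : ℤ).natAbs := by simpa [Int.gcd_zero_right] using hp
  rcases Int.natAbs_eq_natAbs_iff.mp hx with rfl | rfl <;> simp [nm']

theorem nm'_eq_seven_of_imag_primitive {x y : ℤ} (hx : x = 0) (hp : Int.gcd x y = 1) :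
    nm' x y = 7 := by
  subst hx
  have hy : y.natAbs = (1 : ℤ).natAbs := by simpa [Int.gcd_zero_left] using hp
  rcases Int.natAbs_eq_natAbs_iff.mp hy with rfl | rfl <;> simp [nm']

theorem odd_nm'_of_eigen_primitive {x y : ℤ} (h : y = 0 ∨ x = 0) (hp : Int.gcd x y = 1) :
    Odd (nm' x y) := by
  rcases h with h | h
  · rw [nm'_eq_one_of_real_primitive h hp]; exact odd_one
  · rw [nm'_eq_seven_of_imag_primitive h hp]; exact ⟨3, by norm_num⟩


/-! ### §5b  Kato's COHOMOLOGICAL normalisation (14.18) and the index digit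

Conjugation on `H₁ = ℤγ₀ ⊕ ℤωγ₀` (maximal type, `γ̄₀ = γ₀`, `ω̄γ₀ = γ₀ − ωγ₀`) is the matrix
`M = [[1,1],[0,−1]]`; on the DUAL lattice `H¹ = Hom(H₁, ℤ)` a row vector `(a, b)` goes to
`(a, b)·M = (a, a − b)`.  The fixed rows are `a = 2b`, primitive one `±(2, 1)`, which evaluates to
`2` on the fixed generator `γ₀` of `H₁⁺`: `[H¹ : H¹⁺ ⊕ H¹⁻] = 2` and Kato's `Ω₊ = per(ω)(γ₀)/2 = Ω₀/2`
(likewise `Ω₋ = √−7·Ω₀/2`).  For the order `ℤ[√−7]` (basis `γ₀, √−7γ₀`, `M′ = diag(1, −1)`) the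
index is `1` and `Ω₊ = Ω₀`.  Since `ord_𝔭 2 = 1` (`2 = 𝔭𝔭̄` splits), the Betti digit `κaK` is `−1` on
maximal-type members and `0` on order-`2`-type members: ONE dyadic digit, decided by the CM-order
type (equivalently by `sign Δ(A′)`, i.e. `c_∞(A′) ∈ {1, 2}`), by nothing else. -/

/-- Dual action of conjugation, maximal type: `(a, b) ↦ (a, a − b)`; fixed iff `a = 2b`. -/
theorem dualRow_fixed_iff (a b : ℤ) : ((a, a - b) : ℤ × ℤ) = (a, b) ↔ a = 2 * b := by
  rw [Prod.mk.injEq]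
  omega

/-- … anti-fixed iff `a = 0`. -/
theorem dualRow_anti_iff (a b : ℤ) : ((a, a - b) : ℤ × ℤ) = (-a, -b) ↔ a = 0 := by
  rw [Prod.mk.injEq]
  omega

/-- The primitive fixed row is `±(2, 1)`: a fixed row `(2b, b)` with `gcd = 1` has `b = ±1`, and it
evaluates to `2b = ±2` on `γ₀ = e₁` — the INDEX DIGIT `[H¹⁺ : pairing] = 2`. -/
theorem primitive_fixed_dualRow {a b : ℤ} (h : a = 2 * b) (hp : Int.gcd a b = 1) :
    (a = 2 ∧ b = 1) ∨ (a = -2 ∧ b = -1) := by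
  subst h
  have hdvd : b ∣ (Int.gcd (2 * b) b : ℤ) := Int.dvd_coe_gcd ⟨2, by ring⟩ (dvd_refl b)
  rw [hp] at hdvd
  rcases Int.isUnit_iff.mp (isUnit_of_dvd_one (by exact_mod_cast hdvd)) with rfl | rfl
  · left; constructor <;> norm_num
  · right; constructor <;> norm_num

/-- The primitive anti-fixed row is `±(0, 1)`; it evaluates to `∓2` on the anti-fixed generator
`(1 − 2ω)γ₀ = −√−7·γ₀` of `H₁⁻` (coordinates `(1, −2)`): again the index digit `2`. -/
theorem primitive_anti_dualRow_pairing {a b : ℤ} (h : a = 0) (hp : Int.gcd a b = 1) :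
    a * 1 + b * (-2) = -2 ∨ a * 1 + b * (-2) = 2 := by
  subst h
  have hb : b.natAbs = (1 : ℤ).natAbs := by simpa [Int.gcd_zero_left] using hp
  rcases Int.natAbs_eq_natAbs_iff.mp hb with rfl | rfl <;> simp

/-- Order-`2` type (`ℤ[√−7]`, basis `γ₀, √−7γ₀`, conjugation `diag(1, −1)` on rows too): the
primitive fixed row `±(1, 0)` pairs to `±1` with `γ₀` — index digit `1`, no dyadic digit. -/
theorem primitive_fixed_dualRow' {a b : ℤ} (h : ((a, -b) : ℤ × ℤ) = (a, b)) (hp : Int.gcd a b = 1) :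
    a * 1 + b * 0 = 1 ∨ a * 1 + b * 0 = -1 := by
  rw [Prod.mk.injEq] at h
  have hb : b = 0 := by omega
  subst hb
  have ha : a.natAbs = (1 : ℤ).natAbs := by simpa [Int.gcd_zero_right] using hp
  rcases Int.natAbs_eq_natAbs_iff.mp ha with rfl | rfl <;> simp

/-- `sign Δ = sign (j − 1728)` (from `1728Δ = c₄³ − c₆²`, `c₆² = (j − 1728)Δ` when `c₆ ≠ 0`):
`j(49a1) = −3375 < 1728 < 16581375 = j(49a2)`, so maximal-type members have `Δ < 0` (`c_∞ = 1`,
index `2`) and order-`2`-type members `Δ > 0` (`c_∞ = 2`, index `1`) — for every twist. -/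
theorem j_table : (-3375 : ℤ) < 1728 ∧ (1728 : ℤ) < 16581375 ∧ (16581375 : ℤ) = 255 ^ 3 ∧
    (-3375 : ℤ) = (-15) ^ 3 := by norm_num

end Lattice

/-! ## §6  From odd norm to «generator at both primes above 2» -/

section Units

/-- An odd integer is a `2`-adic unit. -/
theorem isUnit_padicInt_two_of_odd {n : ℤ} (hn : Odd n) : IsUnit ((n : ℤ_[2])) := by
  rw [PadicInt.isUnit_iff]
  have h1 : ‖(n : ℤ_[2])‖ ≤ 1 := PadicInt.norm_le_one _
  have h2 : ¬ ‖(n : ℤ_[2])‖ < 1 := by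
    rw [PadicInt.norm_int_lt_one_iff_dvd]
    intro h
    exact (Int.not_even_iff_odd.mpr hn) (even_iff_two_dvd.mpr (by exact_mod_cast h))
  exact le_antisymm h1 (not_lt.mp h2)

/-- `c c̄ = N(c)` a unit ⟹ `c` a unit: in `O ⊗ ℤ₂ = O_𝔭 × O_𝔭̄` the eigenvector `c` generates at
BOTH primes above `2`, so its `𝔭`-position (and `𝔭̄`-position) is `0`. -/
theorem isUnit_of_mul_conj {R : Type*} [CommMonoid R] {c cbar : R} (h : IsUnit (c * cbar)) :
    IsUnit c :=
  isUnit_of_mul_isUnit_left h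

/-- The two norms that occur, as `2`-adic units. -/
theorem norms_are_two_adic_units : IsUnit ((1 : ℤ) : ℤ_[2]) ∧ IsUnit ((7 : ℤ) : ℤ_[2]) :=
  ⟨isUnit_padicInt_two_of_odd odd_one, isUnit_padicInt_two_of_odd ⟨3, by norm_num⟩⟩

/-- `−7` is an odd square modulo `64` (`11² = 121 ≡ −7`); with `−7 ≡ 1 (mod 8)` and Hensel,
`√−7 ∈ ℤ₂ˣ`: `2` SPLITS in `K₀` and `√−7` is a `2`-adic unit — the reason `Ω₋ = √−7 · Ω₊`
(resp. `Ω₊/√−7`) of `cm7` carries no dyadic digit. -/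
theorem neg_seven_sq_mod_64 : ∃ x : ZMod 64, x ^ 2 = -7 := ⟨11, by decide⟩

theorem neg_seven_mod_eight : (-7 : ℤ) % 8 = 1 := by decide

end Units

/-! ## §7  Key tables (decidable) -/

section Keys

/-- Representatives `(d, e)` of the six dyadic keys `(d mod 2, d′ mod 8) ∈
{(1,7),(1,3),(0,1),(0,7),(0,3),(0,5)}` with the partner sign `e ∈ {−1, 2, −2}`
(`A′ = W^{(e)}` good ordinary at `2`). -/
def keyReps : List (ℤ × ℤ) := [(7, -1), (3, -1), (2, 2), (14, -2), (6, -2), (10, 2)]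

/-- `D(d, e)`: the square-free kernel of `d·e` at `2` (divide out `4` when `d`, `e` are both even). -/
def partnerD (p : ℤ × ℤ) : ℤ := if p.1 * p.2 % 4 = 0 then p.1 * p.2 / 4 else p.1 * p.2

/-- The partner `A′ = cm7^{(D)}` is GOOD at `2` on every key: `D ≡ 1 (mod 4)`. -/
theorem partner_good : ∀ p ∈ keyReps, partnerD p % 4 = 1 := by decide

/-- `D mod 8` per key — the class deciding `A′/ℚ₂` (`cm7` or its unramified quadratic twist), hence
the unit root `α = ±α(cm7)` and `χ_D(2)`: KEY data, valuation-free. -/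
theorem unitRootClass_table : keyReps.map (fun p => partnerD p % 8) = [1, 5, 1, 1, 5, 5] := by
  decide

/-- The sign of `d` is NOT a key invariant: `d = 3 > 0` and `d = −5 < 0` lie in the same class of
`ℚ₂ˣ/(ℚ₂ˣ)²` (`3 · (−5) = −15 ≡ 1 (mod 8)` is an odd `2`-adic square), both in key `(1,3)`.  A digit
law reading `Ω_{sgn d}(cm7)` would therefore NOT be key-uniform unless `Ω₋/Ω₊ = √−7` is a `2`-adic
unit — which §5–§6 provide. -/
theorem same_key_opposite_signs : (3 * (-5) : ℤ) % 8 = 1 ∧ (3 : ℤ) % 8 = (-5 : ℤ) % 8 := by decide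


/-! ### §7b  The isogeny digit for order-`2`-type members (decidable core)

`cm7 = 49a1 = [1, −1, 0, −2, −1]` (maximal type) carries the rational `2`-torsion point `T = (2, −1)`
(`x = 2` is a root of the `2`-division cubic `4x³ + b₂x² + 2b₄x + b₆ = 4x³ − 3x² − 8x − 4`); `T` is an
INTEGRAL point, so it is not in the formal group at `2` (`E₁(ℚ₂) = {v₂(x) < 0}`): the kernel `⟨T⟩` of
`49a1 → 49a2` is ÉTALE at `2`, hence the dual («up») isogeny `φ̂ : 49a2 → 49a1` has CONNECTED kernel,
`φ̂` is `[2]∘(unit)` on formal groups and `φ̂^*ω_{49a1} = ±2·ω_{49a2}` at `2`.  Twisting by the odd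
`D ≡ 1 (mod 4)` of `partner_good` does not change the finite-flat type of the kernel over `ℤ₂^{ur}`.
In the period-pair bookkeeping the scalar `c_{φ̂} = ±2` is a DIFFERENTIAL scalar (it cancels,
`periodDigit_rescale`), while the formal-group factor `n = 2·unit` sits in the crystalline entry of
the de Shalit side: `κuZ = −1` for order-`2`-type members — the same single digit that maximal-type
members carry as the index digit `κaK = −1` (§5b).  Net: `ord π_W − ord(A/B) = 1` for EVERY member. -/

/-- `b`-invariants of `49a1 = [1, −1, 0, −2, −1]`: `b₂ = a₁² + 4a₂ = −3`, `b₄ = 2a₄ + a₁a₃ = −4`,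
`b₆ = a₃² + 4a₆ = −4`. -/
theorem cm7_b_invariants :
    ((1 : ℤ) ^ 2 + 4 * (-1) = -3) ∧ ((2 : ℤ) * (-2) + 1 * 0 = -4) ∧ ((0 : ℤ) ^ 2 + 4 * (-1) = -4) := by
  norm_num

/-- `x = 2` is a root of the `2`-division cubic of `49a1`, and `T = (2, −1)` lies on
`y² + xy = x³ − x² − 2x − 1`: a rational `2`-torsion point with INTEGRAL coordinates. -/
theorem cm7_rational_two_torsion :
    (4 * (2 : ℤ) ^ 3 + (-3) * 2 ^ 2 + 2 * (-4) * 2 + (-4) = 0) ∧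
    ((-1 : ℤ) ^ 2 + 2 * (-1) = 2 ^ 3 - 2 ^ 2 - 2 * 2 - 1) := by
  norm_num

/-- Reduction of `49a1` at `2`: `y² + xy = x³ + x² + 1` over `𝔽₂` has exactly ONE affine point,
`(0, 1)` — so `#Ẽ(𝔽₂) = 2`, `a₂ = 1` (ordinary, `= Tr (1+√−7)/2`), and `T = (2, −1) ↦ (0, 1) ≠ O`:
`T` is not in the kernel of reduction. -/
theorem cm7_mod_two_points :
    ((Finset.univ : Finset (ZMod 2 × ZMod 2)).filter
        (fun q => q.2 ^ 2 + q.1 * q.2 = q.1 ^ 3 + q.1 ^ 2 + 1)) = {((0 : ZMod 2), (1 : ZMod 2))} := by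
  decide

end Keys

/-! ## §8  A firing instance (non-vacuity of the bookkeeping) -/

section Fire

/-- The trivial valuation on any comm group. -/
def trivVal (Γ : Type*) [CommGroup Γ] : Γ →* Multiplicative ℤ := 1

example : ∃ c : ℤ, ∀ i : Fin 6,
    ord (trivVal (Multiplicative ℤ))
      (periodDigit ((⟨Multiplicative.ofAdd 3, Multiplicative.ofAdd 5⟩ : PeriodPair _).transport
          (Multiplicative.ofAdd (i : ℤ)) 1 1)
        ((⟨Multiplicative.ofAdd 3, Multiplicative.ofAdd 5⟩ : PeriodPair _).transport 1 1 1)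
        (Multiplicative.ofAdd 2) (Multiplicative.ofAdd 2)) = c :=
  R188_keyUniform (trivVal _) _ (fun i : Fin 6 => Multiplicative.ofAdd (i : ℤ)) (fun _ => 1)
    (fun _ => 1) (fun _ => 1) (fun _ => 1) (fun _ => 1) (fun _ => Multiplicative.ofAdd 2)
    (fun _ => Multiplicative.ofAdd 2) 1 (by simp [ord, trivVal]) (by simp [ord, trivVal])
    (by simp [ord, trivVal]) (by simp [ord, trivVal]) (by simp)

end Fire

end Summit.BirchSwinnertonDyer.BirchSwinnertonDyer.Cruxes.SplitBadTwoLowerHalfOfFacts.PeriodPairK2G29
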